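import Literature.AnabelianGeometry.SemiGraphs.SubgraphComponentsDoubleCosetsOfStabilizers
import Literature.AnabelianGeometry.SemiGraphs.FiniteEtaleCoveringDictionaryProofs
import Literature.AnabelianGeometry.SemiGraphs.CoveringGlobalProofs
import HarnessLib

/-!
# Matched stabilizers for the covering `𝒢_A → 𝒢` from the global clause of its restrictions
([SemiAnbd] Cor. 2.7 (i) p. 30, Rem. 2.2.1 p. 24)

Mochizuki, *Semi-graphs of anabelioids*, Publ. RIMS **42** (2006), §2, proof of Cor. 2.7 (i) p. 30
[cite: MochizukiSemiAnbd2006, Cor. 2.7(i) p.30]; Remark 2.2.1 p. 24 ("the image of each `Π_v` … in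
`Π_𝒢` is equal to the stabilizer of a compatible system of vertices").

abc-iut cell, layer L3, (ASM) piece of the D3b cut (abc-iut-w5-d041).  PROOF-ONLY file (no
definitions, no new named facts).  `SubgraphComponentsDoubleCosetsOfStabilizers.lean` reduces the
dictionary item (D3) at the covering of record `𝒢_A → 𝒢` to the «matched stabilizers» input (ST): at
every vertex `w″ = (u, P)` of every preimage component `K` of a connected sub-graph `ℍ`, ONE point `a` of
the fibre of `A` with `ι_ψ(Π_K) = Stab_{Π_ℍ}(a)` (`ψ = φ|_K`) and `ι″(Π_{𝒢_A}) = Stab_{Π_𝒢}(a)`.  Here (ST)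
is derived from the ONE remaining construction-side statement (abc-iut-L3-d3, «RS-cov»):

  (RS) for every preimage component `K` and the sub-object `m : Z_K ↪ A|_ℍ` of `B(𝒢_ℍ)` cut out by `K`
  (abc-iut-L6-t17's `exists_preimageComponentObject`, characterised by its fibre images), the
  restricted morphism `ψ := (𝒢_A → 𝒢)|_K : 𝒢_A|_K → 𝒢|_ℍ` is GLOBALLY the covering attached to `Z_K`
  (`Hom.IsGlobalCoveringOf`).

The matching point is the TAUTOLOGICAL point `a` of abc-iut-w4-d071's vertex-alignment file
(`CoveringOfObjectVertexAligned.lean`: `range_ι_le_stabilizer`, `map_arrow_basePoint`): (i)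
`ι″(Π_{𝒢_A}) ≤ Stab(a)` and `ι″(Π_{𝒢_A}) = Stab(x₁)` ((D1), abc-iut-L6-d4) have the same finite index
(`Π_𝒢` is transitive on the fibre of the connected `A`), so they are equal; (ii) (D1) for `ψ` w.r.t.
`Z_K` gives `ι_ψ(Π_K) = Stab_{Π_ℍ}(m z₀)`; abc-iut-L6-t17's bridge containment puts it inside
`Stab_{Π_ℍ}(a)`; `a` and `m z₀` lie in the fibre image of the CONNECTED `Z_K` — one `Π_ℍ`-orbit — so the
two stabilizers are conjugate of the same finite index, hence equal.  Nothing here takes a side on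
[IUTchIII] Cor. 3.12; typed ≠ proved for (RS).
-/

namespace Literature.AnabelianGeometry.SemiGraphs

namespace SemiGraphOfAnabelioids

open CategoryTheory CategoryTheory.Limits CategoryTheory.Functor CategoryTheory.PreGaloisCategory
open Literature.AnabelianGeometry.Anabelioids
open scoped Pointwise

universe v₁ u₁ u

/-! ### A. Two group-action lemmas -/

/-- A subgroup contained in a point stabilizer of the same orbit size IS that stabilizer: if
`S ≤ Stab(y)` and `S = Stab(x)` with `x`, `y` in one orbit under a group acting with finite orbits,
then `S = Stab(y)`. [cite: MochizukiSemiAnbd2006, Rem. 2.2.1 p.24] -/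
theorem stabilizer_eq_of_le_of_mem_orbit {G X : Type*} [Group G] [MulAction G X] [Finite X]
    {x y : X} (hle : MulAction.stabilizer G x ≤ MulAction.stabilizer G y)
    (hy : y ∈ MulAction.orbit G x) : MulAction.stabilizer G x = MulAction.stabilizer G y := by
  have hidx : (MulAction.stabilizer G y).index = (MulAction.stabilizer G x).index := by
    rw [MulAction.index_stabilizer, MulAction.index_stabilizer, MulAction.orbit_eq_iff.mpr hy]
  haveI : (MulAction.stabilizer G x).FiniteIndex := by
    refine ⟨?_⟩
    rw [MulAction.index_stabilizer]
    exact (Set.ncard_pos (Set.toFinite _)).mpr ⟨x, MulAction.mem_orbit_self x⟩ |>.ne'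
  by_contra hne
  have hlt : MulAction.stabilizer G x < MulAction.stabilizer G y := lt_of_le_of_ne hle hne
  have := Subgroup.index_strictAnti hlt
  omega

/-- Stabilizers are unchanged along an injective equivariant map.
[cite: MochizukiSemiAnbd2006, Rem. 2.2.1 p.24] -/
theorem stabilizer_eq_of_injective_of_smul {G X Y : Type*} [Group G] [MulAction G X] [MulAction G Y]
    (f : X → Y) (hf : Function.Injective f) (hsmul : ∀ (g : G) (x : X), g • f x = f (g • x)) (x : X) :
    MulAction.stabilizer G (f x) = MulAction.stabilizer G x := by
  ext g
  rw [MulAction.mem_stabilizer_iff, MulAction.mem_stabilizer_iff, hsmul]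
  exact hf.eq_iff

namespace BObj

variable {𝒢 : SemiGraphOfAnabelioids.{v₁, u₁, u}} (A : 𝒢.BObj)

/-! ### B. The local data of `𝒢_A → 𝒢` with the NAMED component functions `vComp`, `eComp` -/

/-- Vertices of `𝔾_A` ↔ components of the `S_v`, for the named component function `vComp`.
[cite: MochizukiSemiAnbd2006, Def. 2.2(i) p.23] -/
theorem vComp_sigma_bijective :
    Function.Bijective (fun vc : A.fibreData.total.Vertex =>
      (⟨A.fibreData.proj.vertexMap vc, A.vComp vc⟩ : Σ v, π₀Obj (A.S v))) := by
  constructor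
  · rintro ⟨v, c⟩ ⟨v', c'⟩ hvc
    change (⟨v, A.vComp ⟨v, c⟩⟩ : Σ w, π₀Obj (A.S w)) = ⟨v', A.vComp ⟨v', c'⟩⟩ at hvc
    obtain ⟨rfl, h2⟩ := Sigma.mk.inj_iff.mp hvc
    obtain rfl : c = c' := (equivShrink _).symm.injective (eq_of_heq h2)
    rfl
  · rintro ⟨v, P⟩
    exact ⟨⟨v, equivShrink _ P⟩, Sigma.ext rfl (heq_of_eq (Equiv.symm_apply_apply _ _))⟩

/-- Edges of `𝔾_A` ↔ components of the `T_e`, for the named component function `eComp`.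
[cite: MochizukiSemiAnbd2006, Def. 2.2(i) p.23] -/
theorem eComp_sigma_bijective :
    Function.Bijective (fun ec : A.fibreData.total.Edge =>
      (⟨A.fibreData.proj.edgeMap ec, A.eComp ec⟩ : Σ e, π₀Obj (A.T e))) := by
  constructor
  · rintro ⟨e, c⟩ ⟨e', c'⟩ hec
    change (⟨e, A.eComp ⟨e, c⟩⟩ : Σ f, π₀Obj (A.T f)) = ⟨e', A.eComp ⟨e', c'⟩⟩ at hec
    obtain ⟨rfl, h2⟩ := Sigma.mk.inj_iff.mp hec
    obtain rfl : c = c' := (equivShrink _).symm.injective (eq_of_heq h2)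
    rfl
  · rintro ⟨e, Q⟩
    exact ⟨⟨e, equivShrink _ Q⟩, Sigma.ext rfl (heq_of_eq (Equiv.symm_apply_apply _ _))⟩

/-- The branch clause of the local description for the named component functions: a branch `(b, Q)`
abutting to `(v, P)` exhibits `Q ⊆ ψ_b(b^* P)`. [cite: MochizukiSemiAnbd2006, Def. 2.2(i) p.23] -/
theorem coveringHom_branchClause (b' : A.fibreData.total.Branch) (v' : A.fibreData.total.Vertex)
    (h' : A.fibreData.total.abuts b' = some v') :
    ∃ f : ((A.eComp (A.fibreData.total.edgeOf b')).1 :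
          𝒢.E (A.fibreData.proj.edgeMap (A.fibreData.total.edgeOf b'))) ⟶
        (𝒢.transportE (A.fibreData.proj.edgeOf_branchMap b')).obj
          ((𝒢.pull (A.fibreData.proj.branchMap b') (A.fibreData.proj.vertexMap v')
            (A.fibreData.proj.abuts_branchMap b' v' h')).pullback.obj
              ((A.vComp v').1 : 𝒢.V (A.fibreData.proj.vertexMap v'))),
      f ≫ (𝒢.transportE (A.fibreData.proj.edgeOf_branchMap b')).map
            ((𝒢.pull _ _ (A.fibreData.proj.abuts_branchMap b' v' h')).pullback.map (A.vComp v').1.arrow ≫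
              (A.ψ (A.fibreData.proj.branchMap b') (A.fibreData.proj.vertexMap v')
                (A.fibreData.proj.abuts_branchMap b' v' h')).hom) ≫
          eqToHom (𝒢.transportE_obj_T A (A.fibreData.proj.edgeOf_branchMap b')) =
        (A.eComp (A.fibreData.total.edgeOf b')).1.arrow := by
  refine ⟨A.inclOfLE (abuts_fst h') (A.vComp v').1 (A.brComp b').1 (brComp_le_branchImage h'), ?_⟩
  change A.inclOfLE (abuts_fst h') (A.vComp v').1 (A.brComp b').1 (brComp_le_branchImage h') ≫
    ((𝒢.pull (A.fibreData.proj.branchMap b') (A.fibreData.proj.vertexMap v') (abuts_fst h')).pullback.map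
        (A.vComp v').1.arrow ≫
      (A.ψ (A.fibreData.proj.branchMap b') (A.fibreData.proj.vertexMap v') (abuts_fst h')).hom) ≫ 𝟙 _ =
    (A.brComp b').1.arrow
  rw [Category.comp_id]
  exact A.inclOfLE_comp _ _ _ _

/-- The sub-object `m : Z_K ↪ A|_ℍ` of `B(𝒢_ℍ)` attached to a preimage component `K` of the covering of
record `𝒢_A → 𝒢` (abc-iut-L6-t17's `exists_preimageComponentObject` at the NAMED local data
`vComp`/`eComp`), with its fibre-image characterisation. [cite: MochizukiSemiAnbd2006, Cor. 2.7(i) p.30] -/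
theorem exists_preimageComponentObject_coveringHom (H : 𝒢.graph.Subgraph) (hHg : H.toSemiGraph.IsGraph)
    (K : A.coveringGraph.graph.Subgraph) (hK : A.coveringHom.IsPreimageComponent H K) :
    ∃ (Z : (𝒢.restrict H).BObj) (m : Z ⟶ (𝒢.restrictFunctor H).obj A), Mono m ∧
      (∀ (w : H.toSemiGraph.Vertex) (Fw : 𝒢.V w.1 ⥤ FintypeCat.{v₁}) [FiberFunctor Fw]
          (y : Fw.obj (A.S w.1)),
        y ∈ Set.range (Fw.map (m.fS w)) ↔ ∃ P : π₀Obj (A.S w.1),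
          (∃ w'' ∈ K.verts,
              (⟨A.fibreData.proj.vertexMap w'', A.vComp w''⟩ : Σ v, π₀Obj (A.S v)) = ⟨w.1, P⟩) ∧
            y ∈ Set.range (Fw.map P.1.arrow)) ∧
      ∀ (e : H.toSemiGraph.Edge) (Fe : 𝒢.E e.1 ⥤ FintypeCat.{v₁}) [FiberFunctor Fe]
          (x : Fe.obj (A.T e.1)),
        x ∈ Set.range (Fe.map (m.fT e)) ↔ ∃ Q : π₀Obj (A.T e.1),
          (∃ e'' ∈ K.edges,
              (⟨A.fibreData.proj.edgeMap e'', A.eComp e''⟩ : Σ e, π₀Obj (A.T e)) = ⟨e.1, Q⟩) ∧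
            x ∈ Set.range (Fe.map Q.1.arrow) :=
  exists_preimageComponentObject A.coveringHom A A.vComp A.eComp A.vComp_sigma_bijective
    A.eComp_sigma_bijective A.coveringHom_branchClause A.fibreData.isProper_proj H hHg K hK

/-! ### C. Matched stabilizers from the global clause of the restrictions -/

/-- **Matched stabilizers for `𝒢_A → 𝒢` from (RS)** ([SemiAnbd] p. 30 with Rem. 2.2.1 p. 24).  Let `𝒢`
be connected with `𝒢_A` connected, `ℍ` a connected sub-graph, and ASSUME (RS): for every preimage
component `K` of `ℍ` under `φ := A.coveringHom` and the sub-object `m : Z_K ↪ A|_ℍ` it cuts out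
(characterised by its fibre images), the restricted morphism `φ|_K : 𝒢_A|_K → 𝒢|_ℍ` is globally the
covering attached to `Z_K`.  THEN at every vertex `w″ = (u, P)` of every `K`, for all constituent
basepoints `(F″, F₂, e₂)`, the TAUTOLOGICAL point `a ∈ F₂(A_u)` (abc-iut-w4-d071) satisfies
`ι_ψ(Π_K) = Stab_{Π_ℍ}(a)` and `ι″(Π_{𝒢_A}) = Stab_{Π_𝒢}(a)` — the input (ST) of
`covering_subgraphComponents_doubleCosets_body_of_stabilizers`.
[cite: MochizukiSemiAnbd2006, Cor. 2.7(i) p.30] -/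
theorem matchedStabilizers_coveringHom_of_restrictGlobal (h𝒢 : 𝒢.IsConnected)
    (hc : A.coveringGraph.IsConnected) (H : 𝒢.graph.Subgraph) (hH : H.toSemiGraph.IsConnected)
    (hHg : H.toSemiGraph.IsGraph)
    (hRS : ∀ (K : {K : A.coveringGraph.graph.Subgraph // A.coveringHom.IsPreimageComponent H K})
      (Z : (𝒢.restrict H).BObj) (m : Z ⟶ (𝒢.restrictFunctor H).obj A), Mono m →
      (∀ (w : H.toSemiGraph.Vertex) (Fw : 𝒢.V w.1 ⥤ FintypeCat.{v₁}) [FiberFunctor Fw]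
          (y : Fw.obj (A.S w.1)),
        y ∈ Set.range (Fw.map (m.fS w)) ↔ ∃ P : π₀Obj (A.S w.1),
          (∃ w'' ∈ K.1.verts,
              (⟨A.fibreData.proj.vertexMap w'', A.vComp w''⟩ : Σ v, π₀Obj (A.S v)) = ⟨w.1, P⟩) ∧
            y ∈ Set.range (Fw.map P.1.arrow)) →
      (∀ (e : H.toSemiGraph.Edge) (Fe : 𝒢.E e.1 ⥤ FintypeCat.{v₁}) [FiberFunctor Fe]
          (x : Fe.obj (A.T e.1)),
        x ∈ Set.range (Fe.map (m.fT e)) ↔ ∃ Q : π₀Obj (A.T e.1),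
          (∃ e'' ∈ K.1.edges,
              (⟨A.fibreData.proj.edgeMap e'', A.eComp e''⟩ : Σ e, π₀Obj (A.T e)) = ⟨e.1, Q⟩) ∧
            x ∈ Set.range (Fe.map Q.1.arrow)) →
      (A.coveringHom.restrict K.1 H K.2.2.2.2.1 K.2.2.2.2.2.1).IsGlobalCoveringOf Z)
    (K : {K : A.coveringGraph.graph.Subgraph // A.coveringHom.IsPreimageComponent H K})
    (w'' : K.1.toSemiGraph.Vertex) (F'' : A.coveringGraph.V w''.1 ⥤ FintypeCat.{v₁}) [FiberFunctor F'']
    (F₂ : 𝒢.V (A.coveringHom.base.vertexMap w''.1) ⥤ FintypeCat.{v₁}) [FiberFunctor F₂]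
    (e₂ : (A.coveringHom.φV w''.1).pullback ⋙ F'' ≅ F₂) :
    ∃ a : (𝒢.ρ (A.coveringHom.base.vertexMap w''.1) ⋙ F₂).obj A,
      ((Aut.autMulEquivOfIso
            (isoWhiskerLeft
              ((𝒢.restrict H).ρ ⟨A.coveringHom.base.vertexMap w''.1, K.2.2.2.2.1 w''.2⟩) e₂)).toMonoidHom.comp
          (pi1Map (A.coveringHom.restrict K.1 H K.2.2.2.2.1 K.2.2.2.2.2.1).pullbackFunctor
            ((A.coveringGraph.restrict K.1).ρ w'' ⋙ F''))).range =
        MulAction.stabilizer (𝒢.PiH H ⟨A.coveringHom.base.vertexMap w''.1, K.2.2.2.2.1 w''.2⟩ F₂)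
          (show ((𝒢.restrict H).ρ ⟨A.coveringHom.base.vertexMap w''.1, K.2.2.2.2.1 w''.2⟩ ⋙ F₂).obj
            ((𝒢.restrictFunctor H).obj A) from a) ∧
      ((Aut.autMulEquivOfIso (isoWhiskerLeft (𝒢.ρ (A.coveringHom.base.vertexMap w''.1)) e₂)
          ).toMonoidHom.comp
          (pi1Map A.coveringHom.pullbackFunctor (A.coveringGraph.ρ w''.1 ⋙ F''))).range =
        MulAction.stabilizer (𝒢.Pi (A.coveringHom.base.vertexMap w''.1) F₂) a := by
  classical
  obtain ⟨t⟩ := A.nonempty_fiber_mkId w''.1 F''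
  have hKV : K.1.verts ⊆ A.coveringHom.base.vertexMap ⁻¹' H.verts := K.2.2.2.2.1
  have hKE : K.1.edges ⊆ A.coveringHom.base.edgeMap ⁻¹' H.edges := K.2.2.2.2.2.1
  -- Galois structures on `B(𝒢)` and `B(𝒢_ℍ)`, basepoints through `u := φ w″` read via `F₂`
  letI := 𝒢.preGaloisCategory_bObj
  letI := 𝒢.galoisCategory_bObj h𝒢
  letI := (𝒢.restrict H).preGaloisCategory_bObj
  letI := (𝒢.restrict H).galoisCategory_bObj ⟨hH⟩
  let u : 𝒢.graph.Vertex := A.coveringHom.base.vertexMap w''.1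
  let uH : H.toSemiGraph.Vertex := ⟨u, hKV w''.2⟩
  let Φ : 𝒢.BObj ⥤ FintypeCat.{v₁} := 𝒢.ρ u ⋙ F₂
  haveI : FiberFunctor Φ := 𝒢.fiberFunctor_ρ h𝒢 u F₂
  let ΦH : (𝒢.restrict H).BObj ⥤ FintypeCat.{v₁} := (𝒢.restrict H).ρ uH ⋙ F₂
  haveI : FiberFunctor ΦH :=
    @SemiGraphOfAnabelioids.fiberFunctor_ρ (𝒢.restrict H) ⟨hH⟩ uH F₂ ‹FiberFunctor F₂›
  let AH : (𝒢.restrict H).BObj := (𝒢.restrictFunctor H).obj A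
  -- the two homomorphisms of the statement
  let ι : Aut (A.coveringGraph.ρ w''.1 ⋙ F'') →* Aut Φ :=
    (Aut.autMulEquivOfIso (isoWhiskerLeft (𝒢.ρ u) e₂)).toMonoidHom.comp
      (pi1Map A.coveringHom.pullbackFunctor (A.coveringGraph.ρ w''.1 ⋙ F''))
  let ψ := A.coveringHom.restrict K.1 H hKV hKE
  let ιψ : Aut ((A.coveringGraph.restrict K.1).ρ w'' ⋙ F'') →* Aut ΦH :=
    (Aut.autMulEquivOfIso (isoWhiskerLeft ((𝒢.restrict H).ρ uH) e₂)).toMonoidHom.comp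
      (pi1Map ψ.pullbackFunctor ((A.coveringGraph.restrict K.1).ρ w'' ⋙ F''))
  change ∃ a : Φ.obj A, ιψ.range = MulAction.stabilizer (Aut ΦH) (show ΦH.obj AH from a) ∧
    ι.range = MulAction.stabilizer (Aut Φ) a
  -- `A` is connected (the covering is global)
  have hBφ : A.coveringHom.IsGlobalCoveringOf A := by
    rw [← coveringHomCan_eq_coveringHom]
    exact A.coveringHomCan_isGlobalCoveringOf
  haveI hA : PreGaloisCategory.IsConnected A := isConnected_of_isGlobalCovering hc A.coveringHom A hBφ
  -- Step A: the tautological point `a`, fixed by `Π′`, lying in the fibre image of `P = vComp w″`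
  let a : Φ.obj A :=
    e₂.hom.app (A.S u)
      (F''.map ((Shrink.equivalence
          (Over ((A.vComp w''.1).1 : 𝒢.V (A.fibreData.proj.vertexMap w''.1)))).functor.map
        ((Over.forgetAdjStar ((A.vComp w''.1).1 : 𝒢.V (A.fibreData.proj.vertexMap w''.1))).unit.app
            (Over.mk (𝟙 _)) ≫
          (Over.star ((A.vComp w''.1).1 : 𝒢.V (A.fibreData.proj.vertexMap w''.1))).map
            (A.vComp w''.1).1.arrow)) t)
  have hle : ι.range ≤ MulAction.stabilizer (Aut Φ) a := A.range_ι_le_stabilizer w''.1 F'' F₂ e₂ t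
  have ha_mem : a ∈ Set.range (F₂.map (A.vComp w''.1).1.arrow) :=
    ⟨_, A.map_arrow_basePoint w''.1 F'' F₂ e₂ t⟩
  -- Step B: `ι(Π_{𝒢_A}) = Stab(a)` — (D1) gives a stabilizer of the same (finite) index inside `Stab(a)`
  have hι : ι.range = MulAction.stabilizer (Aut Φ) a := by
    obtain ⟨x₁, -, hx₁⟩ :=
      covering_decompositionGroup_of_isBObjCovering h𝒢 hc A.coveringHom A hBφ w''.1 F'' F₂ e₂
    have hx₁' : ι.range = MulAction.stabilizer (Aut Φ) x₁ := hx₁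
    rw [hx₁'] at hle ⊢
    obtain ⟨g, hg⟩ := MulAction.exists_smul_eq (Aut Φ) x₁ a
    exact stabilizer_eq_of_le_of_mem_orbit hle (MulAction.mem_orbit_iff.mpr ⟨g, hg⟩)
  -- Step C: the sub-object `Z_K ↪ A|_ℍ` and the global clause for `ψ = φ|_K` (RS)
  obtain ⟨Z, m, hmono, hmS, hmT⟩ := A.exists_preimageComponentObject_coveringHom H hHg K.1 K.2
  haveI := hmono
  have hglob : ψ.IsGlobalCoveringOf Z := hRS K Z m hmono hmS hmT
  have hKc : (A.coveringGraph.restrict K.1).IsConnected := ⟨K.2.1⟩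
  have hHc : (𝒢.restrict H).IsConnected := ⟨hH⟩
  -- Step D: (D1) for `ψ`: `ι_ψ(Π_K) = Stab_{Π_ℍ}(z₀)` for a point `z₀` of the fibre of `Z`
  -- (the constituents of the restricted semi-graphs are those of `𝒢_A`, `𝒢` DEFINITIONALLY but not
  -- reducibly, so the basepoint instances are passed explicitly)
  obtain ⟨z₀, -, hz₀⟩ :=
    @covering_decompositionGroup_of_isBObjCovering (𝒢.restrict H) (A.coveringGraph.restrict K.1) hHc hKc ψ
      Z hglob w'' F'' ‹FiberFunctor F''› F₂ ‹FiberFunctor F₂› e₂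
  let zH : ΦH.obj Z := z₀
  have hz₀' : ιψ.range = MulAction.stabilizer (Aut ΦH) zH := hz₀
  -- Step E: move `z₀` into the fibre of `A|_ℍ` along the mono `m`
  let a₀ : ΦH.obj AH := ΦH.map m zH
  have hinj : Function.Injective (ΦH.map m) := by
    haveI : @Mono (𝒢.V u) _ _ _ (m.fS uH) := (𝒢.restrict H).mono_fS m uH
    change Function.Injective (F₂.map (m.fS uH))
    exact ConcreteCategory.injective_of_mono_of_preservesPullback (F₂.map (m.fS uH))
  have hsmul : ∀ (σ : Aut ΦH) (z : ΦH.obj Z), σ • ΦH.map m z = ΦH.map m (σ • z) := by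
    intro σ z
    rw [mulAction_def, mulAction_def]
    have h := ConcreteCategory.congr_hom (σ.hom.naturality m) z
    simp only [FintypeCat.comp_apply] at h
    exact h
  have hSa₀ : MulAction.stabilizer (Aut ΦH) a₀ = MulAction.stabilizer (Aut ΦH) zH :=
    stabilizer_eq_of_injective_of_smul _ hinj hsmul zH
  -- Step F: containment `Stab_{Π_ℍ}(a₀) ≤ Stab_{Π_ℍ}(a)` (abc-iut-L6-t17's bridge containment)
  have hmap : ιψ.range.map (𝒢.piHToPi H uH F₂) ≤ MulAction.stabilizer (Aut Φ) a := by
    rw [← hι, ← A.coveringHom.range_ι_comp_piHToPi_eq_map K.1 H hKV hKE w'' F'' F₂ e₂]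
    exact (A.coveringHom.range_ι_comp_piHToPi_le K.1 H hKV hKE w'' F'' F₂ e₂).trans inf_le_left
  have hcont : MulAction.stabilizer (Aut ΦH) a₀ ≤
      MulAction.stabilizer (Aut ΦH) (show ΦH.obj AH from a) := by
    intro h hh
    rw [hSa₀, ← hz₀'] at hh
    have h1 : 𝒢.piHToPi H uH F₂ h ∈ MulAction.stabilizer (Aut Φ) a := hmap ⟨h, hh, rfl⟩
    exact h1
  -- Step G: `a` lies in the fibre image of the CONNECTED `Z`, i.e. in the `Π_ℍ`-orbit of `a₀`
  haveI hZc : PreGaloisCategory.IsConnected Z := isConnected_of_isGlobalCovering hKc ψ Z hglob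
  have ha' : (show ΦH.obj AH from a) ∈ Set.range (ΦH.map m) :=
    (hmS uH F₂ a).mpr ⟨A.vComp w''.1, ⟨w''.1, w''.2, rfl⟩, ha_mem⟩
  have horb : (show ΦH.obj AH from a) ∈ MulAction.orbit (Aut ΦH) a₀ := by
    rw [← range_map_eq_orbit_of_isConnected ΦH m zH]
    exact ha'
  -- Step H: equal stabilizers (same orbit, one inside the other)
  have hψ : ιψ.range = MulAction.stabilizer (Aut ΦH) (show ΦH.obj AH from a) := by
    rw [hz₀', ← hSa₀]
    exact stabilizer_eq_of_le_of_mem_orbit hcont horb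
  exact ⟨a, hψ, hι⟩

end BObj

/-- **(ST) for the covering of record `A.coveringHomCan`, from (RS)** — the hypothesis `hSTcov` of
`subgraphComponents_doubleCosets_coveringHomCan_of_stabilizers`
(`SubgraphComponentsDoubleCosetsOfStabilizers.lean`), transported from `coveringHom` along
`coveringHomCan_eq_coveringHom`.  The ONE hypothesis is (RS) for `A.coveringHomCan`: for every preimage
component `K` of a connected sub-graph `ℍ` and every sub-object `m : Z ↪ A|_ℍ` of `B(𝒢_ℍ)` with the fibre
images cut out by `K` (vertexwise via `vComp`, edgewise via `eComp`), the restricted morphism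
`A.coveringHomCan|_K : 𝒢_A|_K → 𝒢|_ℍ` is globally the covering attached to `Z` (abc-iut-L3-d3, RS-cov).
[cite: MochizukiSemiAnbd2006, Cor. 2.7(i) p.30] -/
theorem matchedStabilizers_coveringHomCan_of_restrictGlobal
    (hRS : ∀ (𝒢 : SemiGraphOfAnabelioids.{v₁, u₁, u}) (A : 𝒢.BObj),
      𝒢.IsConnected → A.coveringGraph.IsConnected →
      ∀ (H : 𝒢.graph.Subgraph), H.toSemiGraph.IsConnected → H.toSemiGraph.IsGraph →
      ∀ (K : {K : A.coveringGraph.graph.Subgraph // A.coveringHomCan.IsPreimageComponent H K})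
        (Z : (𝒢.restrict H).BObj) (m : Z ⟶ (𝒢.restrictFunctor H).obj A), Mono m →
        (∀ (w : H.toSemiGraph.Vertex) (Fw : 𝒢.V w.1 ⥤ FintypeCat.{v₁}) [FiberFunctor Fw]
            (y : Fw.obj (A.S w.1)),
          y ∈ Set.range (Fw.map (m.fS w)) ↔ ∃ P : π₀Obj (A.S w.1),
            (∃ w'' ∈ K.1.verts,
                (⟨A.fibreData.proj.vertexMap w'', A.vComp w''⟩ : Σ v, π₀Obj (A.S v)) = ⟨w.1, P⟩) ∧
              y ∈ Set.range (Fw.map P.1.arrow)) →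
        (∀ (e : H.toSemiGraph.Edge) (Fe : 𝒢.E e.1 ⥤ FintypeCat.{v₁}) [FiberFunctor Fe]
            (x : Fe.obj (A.T e.1)),
          x ∈ Set.range (Fe.map (m.fT e)) ↔ ∃ Q : π₀Obj (A.T e.1),
            (∃ e'' ∈ K.1.edges,
                (⟨A.fibreData.proj.edgeMap e'', A.eComp e''⟩ : Σ e, π₀Obj (A.T e)) = ⟨e.1, Q⟩) ∧
              x ∈ Set.range (Fe.map Q.1.arrow)) →
        (A.coveringHomCan.restrict K.1 H K.2.2.2.2.1 K.2.2.2.2.2.1).IsGlobalCoveringOf Z) :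
    ∀ (𝒢 : SemiGraphOfAnabelioids.{v₁, u₁, u}) (A : 𝒢.BObj),
      𝒢.IsConnected → A.coveringGraph.IsConnected →
      ∀ (H : 𝒢.graph.Subgraph), H.toSemiGraph.IsConnected → H.toSemiGraph.IsGraph →
      ∀ (K : {K : A.coveringGraph.graph.Subgraph // A.coveringHomCan.IsPreimageComponent H K})
        (w'' : K.1.toSemiGraph.Vertex) (F'' : A.coveringGraph.V w''.1 ⥤ FintypeCat.{v₁})
        [FiberFunctor F'']
        (F₂ : 𝒢.V (A.coveringHomCan.base.vertexMap w''.1) ⥤ FintypeCat.{v₁}) [FiberFunctor F₂]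
        (e₂ : (A.coveringHomCan.φV w''.1).pullback ⋙ F'' ≅ F₂),
        ∃ a : (𝒢.ρ (A.coveringHomCan.base.vertexMap w''.1) ⋙ F₂).obj A,
          ((Aut.autMulEquivOfIso
                (isoWhiskerLeft
                  ((𝒢.restrict H).ρ ⟨A.coveringHomCan.base.vertexMap w''.1, K.2.2.2.2.1 w''.2⟩)
                  e₂)).toMonoidHom.comp
              (pi1Map (A.coveringHomCan.restrict K.1 H K.2.2.2.2.1 K.2.2.2.2.2.1).pullbackFunctor
                ((A.coveringGraph.restrict K.1).ρ w'' ⋙ F''))).range =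
            MulAction.stabilizer
              (𝒢.PiH H ⟨A.coveringHomCan.base.vertexMap w''.1, K.2.2.2.2.1 w''.2⟩ F₂)
              (show ((𝒢.restrict H).ρ ⟨A.coveringHomCan.base.vertexMap w''.1, K.2.2.2.2.1 w''.2⟩ ⋙
                F₂).obj ((𝒢.restrictFunctor H).obj A) from a) ∧
          ((Aut.autMulEquivOfIso (isoWhiskerLeft (𝒢.ρ (A.coveringHomCan.base.vertexMap w''.1)) e₂)
              ).toMonoidHom.comp
              (pi1Map A.coveringHomCan.pullbackFunctor (A.coveringGraph.ρ w''.1 ⋙ F''))).range =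
            MulAction.stabilizer (𝒢.Pi (A.coveringHomCan.base.vertexMap w''.1) F₂) a := by
  intro 𝒢 A h𝒢 hc H hH hHg
  have h := hRS 𝒢 A h𝒢 hc H hH hHg
  rw [BObj.coveringHomCan_eq_coveringHom] at h ⊢
  intro K w'' F'' _ F₂ _ e₂
  exact A.matchedStabilizers_coveringHom_of_restrictGlobal h𝒢 hc H hH hHg h K w'' F'' F₂ e₂

/-! ### E. The interface of record (abc-iut-w4-d071 v2: Galois objects only) -/

/-- **(ST) for `A.coveringHomCan`, GALOIS objects `A`**, from (RS) restricted to Galois `A` — [SemiAnbd]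
p. 30 applies the dictionary to "a connected finite Galois étale covering", and abc-iut-w4-d071's closer
(v2) carries the premise `IsGalois A`; so (RS) is only needed for Galois `A`.
[cite: MochizukiSemiAnbd2006, Cor. 2.7(i) p.30] -/
theorem matchedStabilizers_coveringHomCan_of_restrictGlobal_galois
    (hRS : ∀ (𝒢 : SemiGraphOfAnabelioids.{v₁, u₁, u}) (A : 𝒢.BObj) (hc : 𝒢.IsConnected),
      @IsGalois 𝒢.BObj _ (𝒢.galoisCategory_bObj hc) A → A.coveringGraph.IsConnected →
      ∀ (H : 𝒢.graph.Subgraph), H.toSemiGraph.IsConnected → H.toSemiGraph.IsGraph →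
      ∀ (K : {K : A.coveringGraph.graph.Subgraph // A.coveringHomCan.IsPreimageComponent H K})
        (Z : (𝒢.restrict H).BObj) (m : Z ⟶ (𝒢.restrictFunctor H).obj A), Mono m →
        (∀ (w : H.toSemiGraph.Vertex) (Fw : 𝒢.V w.1 ⥤ FintypeCat.{v₁}) [FiberFunctor Fw]
            (y : Fw.obj (A.S w.1)),
          y ∈ Set.range (Fw.map (m.fS w)) ↔ ∃ P : π₀Obj (A.S w.1),
            (∃ w'' ∈ K.1.verts,
                (⟨A.fibreData.proj.vertexMap w'', A.vComp w''⟩ : Σ v, π₀Obj (A.S v)) = ⟨w.1, P⟩) ∧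
              y ∈ Set.range (Fw.map P.1.arrow)) →
        (∀ (e : H.toSemiGraph.Edge) (Fe : 𝒢.E e.1 ⥤ FintypeCat.{v₁}) [FiberFunctor Fe]
            (x : Fe.obj (A.T e.1)),
          x ∈ Set.range (Fe.map (m.fT e)) ↔ ∃ Q : π₀Obj (A.T e.1),
            (∃ e'' ∈ K.1.edges,
                (⟨A.fibreData.proj.edgeMap e'', A.eComp e''⟩ : Σ e, π₀Obj (A.T e)) = ⟨e.1, Q⟩) ∧
              x ∈ Set.range (Fe.map Q.1.arrow)) →
        (A.coveringHomCan.restrict K.1 H K.2.2.2.2.1 K.2.2.2.2.2.1).IsGlobalCoveringOf Z) :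
    ∀ (𝒢 : SemiGraphOfAnabelioids.{v₁, u₁, u}) (A : 𝒢.BObj) (hc : 𝒢.IsConnected),
      @IsGalois 𝒢.BObj _ (𝒢.galoisCategory_bObj hc) A → A.coveringGraph.IsConnected →
      ∀ (H : 𝒢.graph.Subgraph), H.toSemiGraph.IsConnected → H.toSemiGraph.IsGraph →
      ∀ (K : {K : A.coveringGraph.graph.Subgraph // A.coveringHomCan.IsPreimageComponent H K})
        (w'' : K.1.toSemiGraph.Vertex) (F'' : A.coveringGraph.V w''.1 ⥤ FintypeCat.{v₁})
        [FiberFunctor F'']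
        (F₂ : 𝒢.V (A.coveringHomCan.base.vertexMap w''.1) ⥤ FintypeCat.{v₁}) [FiberFunctor F₂]
        (e₂ : (A.coveringHomCan.φV w''.1).pullback ⋙ F'' ≅ F₂),
        ∃ a : (𝒢.ρ (A.coveringHomCan.base.vertexMap w''.1) ⋙ F₂).obj A,
          ((Aut.autMulEquivOfIso
                (isoWhiskerLeft
                  ((𝒢.restrict H).ρ ⟨A.coveringHomCan.base.vertexMap w''.1, K.2.2.2.2.1 w''.2⟩)
                  e₂)).toMonoidHom.comp
              (pi1Map (A.coveringHomCan.restrict K.1 H K.2.2.2.2.1 K.2.2.2.2.2.1).pullbackFunctor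
                ((A.coveringGraph.restrict K.1).ρ w'' ⋙ F''))).range =
            MulAction.stabilizer
              (𝒢.PiH H ⟨A.coveringHomCan.base.vertexMap w''.1, K.2.2.2.2.1 w''.2⟩ F₂)
              (show ((𝒢.restrict H).ρ ⟨A.coveringHomCan.base.vertexMap w''.1, K.2.2.2.2.1 w''.2⟩ ⋙
                F₂).obj ((𝒢.restrictFunctor H).obj A) from a) ∧
          ((Aut.autMulEquivOfIso (isoWhiskerLeft (𝒢.ρ (A.coveringHomCan.base.vertexMap w''.1)) e₂)
              ).toMonoidHom.comp
              (pi1Map A.coveringHomCan.pullbackFunctor (A.coveringGraph.ρ w''.1 ⋙ F''))).range =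
            MulAction.stabilizer (𝒢.Pi (A.coveringHomCan.base.vertexMap w''.1) F₂) a := by
  intro 𝒢 A h𝒢 _ hc H hH hHg
  have h := hRS 𝒢 A h𝒢 ‹_› hc H hH hHg
  rw [BObj.coveringHomCan_eq_coveringHom] at h ⊢
  intro K w'' F'' _ F₂ _ e₂
  exact A.matchedStabilizers_coveringHom_of_restrictGlobal h𝒢 hc H hH hHg h K w'' F'' F₂ e₂

/-- **(D3) at the covering of record, for Galois objects — abc-iut-w4-d071's hypothesis `hD3cov` (v2,
VERBATIM) — from (RS) alone.**  Composition of `matchedStabilizers_coveringHomCan_of_restrictGlobal_galois`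
with `covering_subgraphComponents_doubleCosets_body_of_stabilizers`
(`SubgraphComponentsDoubleCosetsOfStabilizers.lean`).  With abc-iut-w4-d071's
`corollary_2_7_i_of_subgraphComponents_doubleCosets_coveringHomCan` (and its Rmk 2.7.2 / Cor 2.7 (ii)
companions) this makes [SemiAnbd] Cor. 2.7 a kernel theorem MODULO (RS) ONLY.
[cite: MochizukiSemiAnbd2006, Cor. 2.7(i) p.30] -/
theorem subgraphComponents_doubleCosets_coveringHomCan_of_restrictGlobal
    (hRS : ∀ (𝒢 : SemiGraphOfAnabelioids.{v₁, u₁, u}) (A : 𝒢.BObj) (hc : 𝒢.IsConnected),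
      @IsGalois 𝒢.BObj _ (𝒢.galoisCategory_bObj hc) A → A.coveringGraph.IsConnected →
      ∀ (H : 𝒢.graph.Subgraph), H.toSemiGraph.IsConnected → H.toSemiGraph.IsGraph →
      ∀ (K : {K : A.coveringGraph.graph.Subgraph // A.coveringHomCan.IsPreimageComponent H K})
        (Z : (𝒢.restrict H).BObj) (m : Z ⟶ (𝒢.restrictFunctor H).obj A), Mono m →
        (∀ (w : H.toSemiGraph.Vertex) (Fw : 𝒢.V w.1 ⥤ FintypeCat.{v₁}) [FiberFunctor Fw]
            (y : Fw.obj (A.S w.1)),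
          y ∈ Set.range (Fw.map (m.fS w)) ↔ ∃ P : π₀Obj (A.S w.1),
            (∃ w'' ∈ K.1.verts,
                (⟨A.fibreData.proj.vertexMap w'', A.vComp w''⟩ : Σ v, π₀Obj (A.S v)) = ⟨w.1, P⟩) ∧
              y ∈ Set.range (Fw.map P.1.arrow)) →
        (∀ (e : H.toSemiGraph.Edge) (Fe : 𝒢.E e.1 ⥤ FintypeCat.{v₁}) [FiberFunctor Fe]
            (x : Fe.obj (A.T e.1)),
          x ∈ Set.range (Fe.map (m.fT e)) ↔ ∃ Q : π₀Obj (A.T e.1),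
            (∃ e'' ∈ K.1.edges,
                (⟨A.fibreData.proj.edgeMap e'', A.eComp e''⟩ : Σ e, π₀Obj (A.T e)) = ⟨e.1, Q⟩) ∧
              x ∈ Set.range (Fe.map Q.1.arrow)) →
        (A.coveringHomCan.restrict K.1 H K.2.2.2.2.1 K.2.2.2.2.2.1).IsGlobalCoveringOf Z) :
    ∀ (𝒢 : SemiGraphOfAnabelioids.{v₁, u₁, u}) (A : 𝒢.BObj) (hc : 𝒢.IsConnected),
      @IsGalois 𝒢.BObj _ (𝒢.galoisCategory_bObj hc) A →
      A.coveringGraph.IsConnected → A.coveringHomCan.IsFiniteEtaleCoveringOf A →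
      A.coveringHomCan.IsGlobalCoveringOf A → A.coveringHomCan.IsVertexAligned →
      ∀ (v' : A.coveringGraph.graph.Vertex) (F' : A.coveringGraph.V v' ⥤ FintypeCat.{v₁})
        [FiberFunctor F'] (F : 𝒢.V (A.coveringHomCan.base.vertexMap v') ⥤ FintypeCat.{v₁})
        [FiberFunctor F] (e : (A.coveringHomCan.φV v').pullback ⋙ F' ≅ F)
        (H : 𝒢.graph.Subgraph), H.toSemiGraph.IsConnected → H.toSemiGraph.IsGraph →
        ∀ (hv : A.coveringHomCan.base.vertexMap v' ∈ H.verts),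
        let v := A.coveringHomCan.base.vertexMap v'
        let ι : A.coveringGraph.Pi v' F' →* 𝒢.Pi v F :=
          (Aut.autMulEquivOfIso (Functor.isoWhiskerLeft (𝒢.ρ v) e)).toMonoidHom.comp
            (pi1Map A.coveringHomCan.pullbackFunctor (A.coveringGraph.ρ v' ⋙ F'))
        let PH : Subgroup (𝒢.Pi v F) := (𝒢.piHToPi H ⟨v, hv⟩ F).range
        ∀ x₀ : (𝒢.ρ v ⋙ F).obj A, ι.range = MulAction.stabilizer (𝒢.Pi v F) x₀ →
          ∃ d : {K : A.coveringGraph.graph.Subgraph // A.coveringHomCan.IsPreimageComponent H K} →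
              𝒢.Pi v F,
            Function.Bijective (fun K => DoubleCoset.mk PH ι.range (d K)) ∧
            (∃ K₀ : {K : A.coveringGraph.graph.Subgraph // A.coveringHomCan.IsPreimageComponent H K},
              v' ∈ K₀.1.verts) ∧
            (∀ (K : {K : A.coveringGraph.graph.Subgraph // A.coveringHomCan.IsPreimageComponent H K})
              (hK : v' ∈ K.1.verts),
              d K ∈ ι.range ∧
                (ι.comp (A.coveringGraph.piHToPi K.1 ⟨v', hK⟩ F')).range = ι.range ⊓ PH) ∧
            ∀ (K : {K : A.coveringGraph.graph.Subgraph // A.coveringHomCan.IsPreimageComponent H K})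
              (w'' : K.1.toSemiGraph.Vertex) (F'' : A.coveringGraph.V w''.1 ⥤ FintypeCat.{v₁})
              [FiberFunctor F''] (α : A.coveringGraph.ρ w''.1 ⋙ F'' ≅ A.coveringGraph.ρ v' ⋙ F'),
              ∃ g : 𝒢.Pi v F,
                (ι.comp ((Aut.autMulEquivOfIso α).toMonoidHom.comp
                  (A.coveringGraph.piHToPi K.1 w'' F''))).range =
                    ι.range ⊓ ConjAct.toConjAct g⁻¹ • PH := by
  intro 𝒢 A hc hG hc' hloc hB _ v' F' _ F _ e H hH hHg hv
  dsimp only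
  intro x₀ hx₀
  exact covering_subgraphComponents_doubleCosets_body_of_stabilizers hc hc' A.coveringHomCan A hloc hB
    v' F' F e H hH hHg hv
    (fun K w'' F'' _ F₂ _ e₂ =>
      matchedStabilizers_coveringHomCan_of_restrictGlobal_galois hRS 𝒢 A hc hG hc' H hH hHg K w'' F'' F₂ e₂)
    x₀ hx₀

end SemiGraphOfAnabelioids

end Literature.AnabelianGeometry.SemiGraphs
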